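import Literature.NumberTheory.Transcendental.KZCubeRationalMoves

/-!
# `ReductionRigidity` (stmt-KontsevichZagierPeriods-3407), line `Sketch` (Padé box island, `w = 2`):
# stub `stub_lineDescent`

THE DESCENT STEP OF THE LINE REDUCTION on the box sector
`S_N = {[□², x^a y^b/(N − xy)^m], [□¹, x^c/(N − x)^m], [pt, q]}` (`□ = [0,1]`, `N ≥ 2`): the lead's
`lineReduction` is an induction on the exponent `c` over this stub and `stub_lineBase`.

* (i) `x = N − (N − x)` as ONE integrand-additivity move (KZ rule (1b), `KZ.integrandAddRel`):
  on the closed interval `N − x ≥ 1`, and pointwise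
  `qN·x^c/(N−x)^{m+1} = q·x^{c+1}/(N−x)^{m+1} + q·x^c/(N−x)^m`, so
  `[q x^{c+1}/(N−x)^{m+1}] ≡ [qN x^c/(N−x)^{m+1}] − [q x^c/(N−x)^m]` (`lineDescent_rule1b`);
* (ii) monomials are rational constants, `[□¹, q x^c] ≡ [pt, q/(c+1)]`: ONE Newton–Leibniz (Stokes)
  move on the closed interval with the polynomial primitive `T = (q/(c+1))·x^{c+1}`, a regular
  rational function on the cube (`KZ.RFun.stokes`): `[∂T] ≡ [T(1)] − [T(0)] = [pt, q/(c+1)] − [pt, 0]`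
  (`lineDescent_monomial`); the derivative `∂T = q x^c` is identified by uniqueness of the
  one-variable derivative along the fibre (`KZ.RFun.hasDerivAt_fn_snoc`), as in `KZ.RFun.rel_lift`.

The arbitrary representations quantified in the registered signature are bridged to these cube
representations by congruence (`KZ.of_sub_of_mem_relations_of_eqOn`).
-/

noncomputable section

open MeasureTheory Set MvPolynomial

namespace Summit.KontsevichZagierPeriods.HermiteRigidity.ReductionRigidity

open Literature.NumberTheory.Transcendental
open Literature.NumberTheory.Transcendental.KZ

/-! ## (i) The descent `x = N − (N − x)` (rule 1b) -/

/-- **Rule (1b) descent**: on `□¹` with `N ≥ 2`,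
`qN·x^c/(N−x)^{m+1} = q·x^{c+1}/(N−x)^{m+1} + q·x^c/(N−x)^m` pointwise, hence
`[q x^{c+1}/(N−x)^{m+1}] − ([qN x^c/(N−x)^{m+1}] − [q x^c/(N−x)^m])` is (minus) an
integrand-additivity relation. [cite: KontsevichZagier2001, §1.2 rule (1)] -/
theorem lineDescent_rule1b {N : ℕ} (hN : 2 ≤ N) (q : ℚ) (c m : ℕ) {r r₁ r₂ : IntegralRep 1}
    (hr : r.domain = cube 1)
    (hri : EqOn r.integrand (fun p => (q : ℝ) * p 0 ^ (c + 1) / ((N : ℝ) - p 0) ^ (m + 1)) (cube 1))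
    (hr₁ : r₁.domain = cube 1)
    (hr₁i : EqOn r₁.integrand
      (fun p => ((q * N : ℚ) : ℝ) * p 0 ^ c / ((N : ℝ) - p 0) ^ (m + 1)) (cube 1))
    (hr₂ : r₂.domain = cube 1)
    (hr₂i : EqOn r₂.integrand (fun p => (q : ℝ) * p 0 ^ c / ((N : ℝ) - p 0) ^ m) (cube 1)) :
    KZ.of r - (KZ.of r₁ - KZ.of r₂) ∈ KZ.relations := by
  have h : KZ.of r₁ - KZ.of r - KZ.of r₂ ∈ KZ.relations := by
    refine integrandAddRel_subset_relations ⟨1, r₁, r, r₂, hr.trans hr₁.symm, hr₂.trans hr₁.symm,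
      fun x hx => ?_, rfl⟩
    rw [hr₁] at hx
    rw [Pi.add_apply, hr₁i hx, hri hx, hr₂i hx]
    show ((q * N : ℚ) : ℝ) * x 0 ^ c / ((N : ℝ) - x 0) ^ (m + 1) =
      (q : ℝ) * x 0 ^ (c + 1) / ((N : ℝ) - x 0) ^ (m + 1) + (q : ℝ) * x 0 ^ c / ((N : ℝ) - x 0) ^ m
    have h2 : (2 : ℝ) ≤ (N : ℝ) := by exact_mod_cast hN
    have hx1 := (hx 0).2
    have hpos : (0 : ℝ) < (N : ℝ) - x 0 := by linarith
    have hne : (N : ℝ) - x 0 ≠ 0 := hpos.ne'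
    push_cast
    field_simp
    ring
  have : KZ.of r - (KZ.of r₁ - KZ.of r₂) = -(KZ.of r₁ - KZ.of r - KZ.of r₂) := by abel
  rw [this]
  exact KZ.relations.neg_mem h

/-! ## (ii) Monomials are rational constants (one Newton–Leibniz move) -/

/-- **`[□¹, q x^c] ≡ [pt, q/(c+1)]`**: one Stokes move on the closed interval with the polynomial
primitive `(q/(c+1))·x^{c+1}` (regular on the cube), whose top face is the constant `q/(c+1)` and
whose bottom face vanishes. [cite: KontsevichZagier2001, §1.2 rule (3)] -/
theorem lineDescent_monomial (q : ℚ) (c : ℕ) (r : IntegralRep 1) (s₀ : IntegralRep 0)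
    (hr : r.domain = cube 1) (hri : EqOn r.integrand (fun p => (q : ℝ) * p 0 ^ c) (cube 1))
    (hs₀ : s₀.domain = cube 0)
    (hs₀i : EqOn s₀.integrand (fun _ => ((q / (c + 1) : ℚ) : ℝ)) (cube 0)) :
    KZ.of r - KZ.of s₀ ∈ KZ.relations := by
  -- the primitive `T = (q/(c+1))·x^{c+1}` as a regular rational function on `[0,1]`
  set T : RFun (0 + 1) := RFun.poly (C (q / (c + 1)) * X 0 ^ (c + 1)) with hT
  have hst := RFun.stokes T
  -- values of `T` along the (only) fibre
  have hTfn : ∀ (x : Fin 0 → ℝ) (s : ℝ),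
      T.fn (Fin.snoc x s) = ((q / (c + 1) : ℚ) : ℝ) * s ^ (c + 1) := by
    intro x s
    simp only [hT, RFun.fn_poly, map_mul, map_pow, aeval_C, aeval_X, eq_ratCast]
    rw [show (0 : Fin (0 + 1)) = Fin.last 0 from rfl, Fin.snoc_last]
  -- `[r] ≡ [∂T]`: the derivative of `T` along the fibre is `q x^c`
  have e1 : KZ.of r - KZ.of T.dlast.rep ∈ KZ.relations := by
    refine KZ.of_sub_of_mem_relations_of_eqOn (by rw [hr]; rfl) fun y hy => ?_
    rw [hr] at hy
    have hy' : Fin.init y ∈ cube 0 := fun i => i.elim0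
    have hlast : y (Fin.last 0) ∈ Icc (0 : ℝ) 1 := ⟨(hy _).1, (hy _).2⟩
    have hd := T.hasDerivAt_fn_snoc hy' hlast
    rw [Fin.snoc_init_self] at hd
    have hd' : HasDerivAt (fun s : ℝ => T.fn (Fin.snoc (Fin.init y) s))
        ((q : ℝ) * y (Fin.last 0) ^ c) (y (Fin.last 0)) := by
      have hfun : (fun s : ℝ => T.fn (Fin.snoc (Fin.init y) s)) =
          fun s => ((q / (c + 1) : ℚ) : ℝ) * s ^ (c + 1) :=
        funext fun s => hTfn _ s
      rw [hfun]
      refine ((hasDerivAt_pow (c + 1) (y (Fin.last 0))).const_mul _).congr_deriv ?_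
      have hc : ((c : ℝ) + 1) ≠ 0 := by positivity
      rw [Nat.add_sub_cancel]
      push_cast
      field_simp
    rw [hri hy]
    exact (hd.unique hd').symm
  -- the top face is the constant `q/(c+1)`
  have e2 : KZ.of (T.face 1 ⟨zero_le_one, le_rfl⟩).rep - KZ.of s₀ ∈ KZ.relations := by
    refine KZ.of_sub_of_mem_relations_of_eqOn (by rw [hs₀]; rfl) fun x _ => ?_
    have hx : x ∈ cube 0 := fun i => i.elim0
    rw [hs₀i hx]
    show (T.face 1 ⟨zero_le_one, le_rfl⟩).fn x = ((q / (c + 1) : ℚ) : ℝ)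
    rw [RFun.fn_face, Rat.cast_one, hTfn, one_pow, mul_one]
  -- the bottom face vanishes
  have e3 : KZ.of (T.face 0 ⟨le_rfl, zero_le_one⟩).rep ∈ KZ.relations :=
    RFun.rel_of_eqOn_zero fun x _ => by
      rw [RFun.fn_face, Rat.cast_zero, hTfn, zero_pow (Nat.succ_ne_zero c), mul_zero]
  have : KZ.of r - KZ.of s₀ =
      (KZ.of r - KZ.of T.dlast.rep)
      + (KZ.of T.dlast.rep -
          (KZ.of (T.face 1 ⟨zero_le_one, le_rfl⟩).rep - KZ.of (T.face 0 ⟨le_rfl, zero_le_one⟩).rep))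
      + (KZ.of (T.face 1 ⟨zero_le_one, le_rfl⟩).rep - KZ.of s₀)
      - KZ.of (T.face 0 ⟨le_rfl, zero_le_one⟩).rep := by abel
  rw [this]
  exact KZ.relations.sub_mem (KZ.relations.add_mem (KZ.relations.add_mem e1 hst) e2) e3

/-! ## The registered stub -/

/-- **Stub `stub_lineDescent`** of line `Sketch` (crux `ReductionRigidity`): (i) the descent
`x = N − (N − x)` as an integrand-additivity congruence
`[q x^{c+1}/(N−x)^{m+1}] ≡ [qN·x^c/(N−x)^{m+1}] − [q·x^c/(N−x)^m]`; (ii) monomials are rational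
constants, `[□¹, q x^c] ≡ [pt, q/(c+1)]` (one Newton–Leibniz move).
[cite: KontsevichZagier2001, §1.2 rules (1) and (3)] -/
theorem stub_lineDescent :
    (∀ (N : ℕ), 2 ≤ N → ∀ (q : ℚ) (c m : ℕ) (r r₁ r₂ : IntegralRep 1),
      r.domain = cube 1 →
      EqOn r.integrand (fun p => (q : ℝ) * p 0 ^ (c + 1) / ((N : ℝ) - p 0) ^ (m + 1)) (cube 1) →
      r₁.domain = cube 1 →
      EqOn r₁.integrand (fun p => ((q * N : ℚ) : ℝ) * p 0 ^ c / ((N : ℝ) - p 0) ^ (m + 1)) (cube 1) →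
      r₂.domain = cube 1 →
      EqOn r₂.integrand (fun p => (q : ℝ) * p 0 ^ c / ((N : ℝ) - p 0) ^ m) (cube 1) →
      KZ.of r - (KZ.of r₁ - KZ.of r₂) ∈ KZ.relations) ∧
    (∀ (q : ℚ) (c : ℕ) (r : IntegralRep 1) (s₀ : IntegralRep 0),
      r.domain = cube 1 → EqOn r.integrand (fun p => (q : ℝ) * p 0 ^ c) (cube 1) →
      s₀.domain = cube 0 → EqOn s₀.integrand (fun _ => ((q / (c + 1) : ℚ) : ℝ)) (cube 0) →
      KZ.of r - KZ.of s₀ ∈ KZ.relations) :=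
  ⟨fun _ hN q c m _ _ _ hr hri hr₁ hr₁i hr₂ hr₂i =>
      lineDescent_rule1b hN q c m hr hri hr₁ hr₁i hr₂ hr₂i,
    fun q c r s₀ hr hri hs₀ hs₀i => lineDescent_monomial q c r s₀ hr hri hs₀ hs₀i⟩

end Summit.KontsevichZagierPeriods.HermiteRigidity.ReductionRigidity
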